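import Summits.CriticalPhenomena.PercolationContinuityZ3.Theorems.PercNearOneGluingNoHeavyLowerTailQuantitativeAntitheticMonotone
import HarnessLib

/-!
# Cross-Harris: the antithetic cross-covariance sum of two nested pairs of up-sets is non-negative (PROOFS §P70 (a3)–(a4), BENCH M2-R104)

Support file (`--supports stmt-CriticalPhenomena-4575`), prover seat `prim-rate-mine-2` (lane prim-rate, constants-miner (c);
`run/shared/lean/prim/prim-rate/prim-rate-mine-2/PROOFS.md` §P70).  No definitions, no named facts, no sorries; standard axioms.

SETTING (as `…QuantitativeAntitheticMonotone`).  `s : Finset α` is the red pair set of the p = ½ complementary («antithetic») coupling and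
`sᶜ` the blue one.  A CROSS functional compares a «rich» reading on the red side with a «poor» reading on the blue side: two up-set families
`𝒜₀ ⊆ 𝒜₁` (the event `{b ↔ x}` read in a subgraph / contraction pair `H − e ⊆ H / e`, or in `H` and in `H/B` with a vertex set glued) and
`ℬ₀ ⊆ ℬ₁` likewise for `{u ↔ x}`; the antithetic CROSS-COVARIANCE SUM is `Σ_s (𝟙_{𝒜₁}(s) − 𝟙_{𝒜₀}(sᶜ))·(𝟙_{ℬ₁}(s) − 𝟙_{ℬ₀}(sᶜ))`.

* `CSH.antithetic_crossSum_eq` — the sum in closed form: `#(𝒜₁ ∩ ℬ₁) − #{s ∈ 𝒜₁ : sᶜ ∈ ℬ₀} − #{s ∈ ℬ₁ : sᶜ ∈ 𝒜₀} + #(𝒜₀ ∩ ℬ₀)`.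
* `CSH.antithetic_crossSum_ge` — **CROSS-HARRIS (quantitative)**: for up-sets `𝒜₀, 𝒜₁, ℬ₀, ℬ₁`,
  `(#𝒜₁ − #𝒜₀)·(#ℬ₁ − #ℬ₀) ≤ 2^{#α} · Σ_s (𝟙_{𝒜₁}(s) − 𝟙_{𝒜₀}(sᶜ))(𝟙_{ℬ₁}(s) − 𝟙_{ℬ₀}(sᶜ))` — Harris–Kleitman four times (twice for two up-sets,
  twice for an up-set against the complement image of an up-set).
* `CSH.antithetic_crossSum_nonneg` — hence `0 ≤ Σ_s (𝟙_{𝒜₁}(s) − 𝟙_{𝒜₀}(sᶜ))(𝟙_{ℬ₁}(s) − 𝟙_{ℬ₀}(sᶜ))` when `𝒜₀ ⊆ 𝒜₁`, `ℬ₀ ⊆ ℬ₁`.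
  USES (PROOFS §P70): (a3) the C-slope of the EDGE-OBSERVER functional `Λ_C(G*, f) = Σ_{X ∋ f}([f ⊆ 𝒞_x(X)] + C)σ_bσ_u` (and of every one-sided glued
  cross functional `Λ_C(H;B)`) is such a sum (`𝒜₁ = {b ↔ x in H/f}`, `𝒜₀ = {b ↔ x in H}`), so `Λ_C` is non-decreasing in `C`; (a4) if `f` is a pair
  AT `x` then `[f ⊆ 𝒞_x] ≡ 1` on `{f red}` and `Λ_C(G*,f) = (1+C)·(this sum) ≥ 0`: pairs at `x` are free in the degree-two reduction
  `CSH.antithetic_nonneg_of_degTwo`.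
[cite: Harris1960, Lemma 4.1 (p. 16)] [cite: AhlswedeDaykin1978, Thm. 1 (p. 183)]
-/

namespace Summit.CriticalPhenomena.PercolationContinuityZ3.Theorems.CSH

open Finset
open scoped FinsetFamily

variable {α : Type*} [Fintype α] [DecidableEq α]

/-- The antithetic cross-covariance sum in closed form:
`Σ_s (𝟙_{𝒜₁}(s) − 𝟙_{𝒜₀}(sᶜ))(𝟙_{ℬ₁}(s) − 𝟙_{ℬ₀}(sᶜ)) = #(𝒜₁ ∩ ℬ₁) − #{s ∈ 𝒜₁ : sᶜ ∈ ℬ₀} − #{s ∈ ℬ₁ : sᶜ ∈ 𝒜₀} + #(𝒜₀ ∩ ℬ₀)`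
(the last term after the complement involution). [cite: Harris1960, Lemma 4.1 (p. 16)] -/
theorem antithetic_crossSum_eq (𝒜₀ 𝒜₁ ℬ₀ ℬ₁ : Finset (Finset α)) :
    (∑ s : Finset α,
        ((if s ∈ 𝒜₁ then (1:ℤ) else 0) - (if sᶜ ∈ 𝒜₀ then (1:ℤ) else 0)) *
          ((if s ∈ ℬ₁ then (1:ℤ) else 0) - (if sᶜ ∈ ℬ₀ then (1:ℤ) else 0)))
      = (#(𝒜₁ ∩ ℬ₁) : ℤ) - (#(𝒜₁.filter fun s => sᶜ ∈ ℬ₀) : ℤ) - (#(ℬ₁.filter fun s => sᶜ ∈ 𝒜₀) : ℤ) + (#(𝒜₀ ∩ ℬ₀) : ℤ) := by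
  have h11 : (∑ s : Finset α, (if s ∈ 𝒜₁ then (1:ℤ) else 0) * (if s ∈ ℬ₁ then (1:ℤ) else 0)) = (#(𝒜₁ ∩ ℬ₁) : ℤ) := by
    have : ∀ s : Finset α, (if s ∈ 𝒜₁ then (1:ℤ) else 0) * (if s ∈ ℬ₁ then (1:ℤ) else 0)
        = if s ∈ 𝒜₁ ∩ ℬ₁ then (1:ℤ) else 0 := fun s => by
      by_cases ha : s ∈ 𝒜₁ <;> by_cases hb : s ∈ ℬ₁ <;> simp [ha, hb]
    simp_rw [this]; rw [Finset.sum_boole]; congr 2; ext s; simp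
  have h10 : (∑ s : Finset α, (if s ∈ 𝒜₁ then (1:ℤ) else 0) * (if sᶜ ∈ ℬ₀ then (1:ℤ) else 0))
      = (#(𝒜₁.filter fun s => sᶜ ∈ ℬ₀) : ℤ) := by
    have : ∀ s : Finset α, (if s ∈ 𝒜₁ then (1:ℤ) else 0) * (if sᶜ ∈ ℬ₀ then (1:ℤ) else 0)
        = if s ∈ 𝒜₁.filter (fun s => sᶜ ∈ ℬ₀) then (1:ℤ) else 0 := fun s => by
      by_cases ha : s ∈ 𝒜₁ <;> by_cases hb : sᶜ ∈ ℬ₀ <;> simp [ha, hb]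
    simp_rw [this]; rw [Finset.sum_boole]; congr 2; ext s; simp
  have h01 : (∑ s : Finset α, (if sᶜ ∈ 𝒜₀ then (1:ℤ) else 0) * (if s ∈ ℬ₁ then (1:ℤ) else 0))
      = (#(ℬ₁.filter fun s => sᶜ ∈ 𝒜₀) : ℤ) := by
    have : ∀ s : Finset α, (if sᶜ ∈ 𝒜₀ then (1:ℤ) else 0) * (if s ∈ ℬ₁ then (1:ℤ) else 0)
        = if s ∈ ℬ₁.filter (fun s => sᶜ ∈ 𝒜₀) then (1:ℤ) else 0 := fun s => by
      by_cases ha : sᶜ ∈ 𝒜₀ <;> by_cases hb : s ∈ ℬ₁ <;> simp [ha, hb]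
    simp_rw [this]; rw [Finset.sum_boole]; congr 2; ext s; simp
  have hinv : Function.Involutive (compl : Finset α → Finset α) := compl_involutive
  have h00 : (∑ s : Finset α, (if sᶜ ∈ 𝒜₀ then (1:ℤ) else 0) * (if sᶜ ∈ ℬ₀ then (1:ℤ) else 0)) = (#(𝒜₀ ∩ ℬ₀) : ℤ) := by
    have h00' : (∑ s : Finset α, (if s ∈ 𝒜₀ then (1:ℤ) else 0) * (if s ∈ ℬ₀ then (1:ℤ) else 0)) = (#(𝒜₀ ∩ ℬ₀) : ℤ) := by
      have : ∀ s : Finset α, (if s ∈ 𝒜₀ then (1:ℤ) else 0) * (if s ∈ ℬ₀ then (1:ℤ) else 0)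
          = if s ∈ 𝒜₀ ∩ ℬ₀ then (1:ℤ) else 0 := fun s => by
        by_cases ha : s ∈ 𝒜₀ <;> by_cases hb : s ∈ ℬ₀ <;> simp [ha, hb]
      simp_rw [this]; rw [Finset.sum_boole]; congr 2; ext s; simp
    rw [← h00']
    exact Equiv.sum_comp hinv.toPerm (fun s => (if s ∈ 𝒜₀ then (1:ℤ) else 0) * (if s ∈ ℬ₀ then (1:ℤ) else 0))
  have hexp : ∀ s : Finset α,
      ((if s ∈ 𝒜₁ then (1:ℤ) else 0) - (if sᶜ ∈ 𝒜₀ then (1:ℤ) else 0)) *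
          ((if s ∈ ℬ₁ then (1:ℤ) else 0) - (if sᶜ ∈ ℬ₀ then (1:ℤ) else 0))
        = (if s ∈ 𝒜₁ then (1:ℤ) else 0) * (if s ∈ ℬ₁ then (1:ℤ) else 0)
          - (if s ∈ 𝒜₁ then (1:ℤ) else 0) * (if sᶜ ∈ ℬ₀ then (1:ℤ) else 0)
          - (if sᶜ ∈ 𝒜₀ then (1:ℤ) else 0) * (if s ∈ ℬ₁ then (1:ℤ) else 0)
          + (if sᶜ ∈ 𝒜₀ then (1:ℤ) else 0) * (if sᶜ ∈ ℬ₀ then (1:ℤ) else 0) := fun s => by ring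
  simp_rw [hexp]
  rw [Finset.sum_add_distrib, Finset.sum_sub_distrib, Finset.sum_sub_distrib, h11, h10, h01, h00]

/-- **CROSS-HARRIS, quantitative form** (PROOFS §P70 (a3)): for up-sets `𝒜₀, 𝒜₁, ℬ₀, ℬ₁` of subsets of a finite type,
`(#𝒜₁ − #𝒜₀)(#ℬ₁ − #ℬ₀) ≤ 2^{#α}·Σ_s (𝟙_{𝒜₁}(s) − 𝟙_{𝒜₀}(sᶜ))(𝟙_{ℬ₁}(s) − 𝟙_{ℬ₀}(sᶜ))` — Harris–Kleitman for `𝒜₁, ℬ₁` and for `𝒜₀, ℬ₀`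
(two up-sets) and for `𝒜₁` against the complement image of `ℬ₀` and `ℬ₁` against that of `𝒜₀` (an up-set against a down-set).
[cite: Harris1960, Lemma 4.1 (p. 16)] [cite: AhlswedeDaykin1978, Thm. 1 (p. 183)] -/
theorem antithetic_crossSum_ge {𝒜₀ 𝒜₁ ℬ₀ ℬ₁ : Finset (Finset α)}
    (up𝒜₀ : IsUpperSet (𝒜₀ : Set (Finset α))) (up𝒜₁ : IsUpperSet (𝒜₁ : Set (Finset α)))
    (upℬ₀ : IsUpperSet (ℬ₀ : Set (Finset α))) (upℬ₁ : IsUpperSet (ℬ₁ : Set (Finset α))) :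
    ((#𝒜₁ : ℤ) - (#𝒜₀ : ℤ)) * ((#ℬ₁ : ℤ) - (#ℬ₀ : ℤ))
      ≤ (2 : ℤ) ^ Fintype.card α * ∑ s : Finset α,
          ((if s ∈ 𝒜₁ then (1:ℤ) else 0) - (if sᶜ ∈ 𝒜₀ then (1:ℤ) else 0)) *
            ((if s ∈ ℬ₁ then (1:ℤ) else 0) - (if sᶜ ∈ ℬ₀ then (1:ℤ) else 0)) := by
  rw [antithetic_crossSum_eq]
  -- the four Harris–Kleitman instances
  have h11 : #𝒜₁ * #ℬ₁ ≤ 2 ^ Fintype.card α * #(𝒜₁ ∩ ℬ₁) := up𝒜₁.le_card_inter_finset upℬ₁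
  have h00 : #𝒜₀ * #ℬ₀ ≤ 2 ^ Fintype.card α * #(𝒜₀ ∩ ℬ₀) := up𝒜₀.le_card_inter_finset upℬ₀
  have hf10 : (𝒜₁.filter fun s => sᶜ ∈ ℬ₀) = 𝒜₁ ∩ ℬ₀ᶜˢ := by ext s; simp [mem_compls]
  have hf01 : (ℬ₁.filter fun s => sᶜ ∈ 𝒜₀) = ℬ₁ ∩ 𝒜₀ᶜˢ := by ext s; simp [mem_compls]
  have h10 : 2 ^ Fintype.card α * #(𝒜₁ ∩ ℬ₀ᶜˢ) ≤ #𝒜₁ * #(ℬ₀ᶜˢ) :=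
    up𝒜₁.card_inter_le_finset (SahiGridPattern.isLowerSet_compls upℬ₀)
  have h01 : 2 ^ Fintype.card α * #(ℬ₁ ∩ 𝒜₀ᶜˢ) ≤ #ℬ₁ * #(𝒜₀ᶜˢ) :=
    upℬ₁.card_inter_le_finset (SahiGridPattern.isLowerSet_compls up𝒜₀)
  rw [card_compls] at h10 h01
  rw [hf10, hf01]
  have e11 : ((#𝒜₁ * #ℬ₁ : ℕ) : ℤ) ≤ ((2 ^ Fintype.card α * #(𝒜₁ ∩ ℬ₁) : ℕ) : ℤ) := by exact_mod_cast h11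
  have e00 : ((#𝒜₀ * #ℬ₀ : ℕ) : ℤ) ≤ ((2 ^ Fintype.card α * #(𝒜₀ ∩ ℬ₀) : ℕ) : ℤ) := by exact_mod_cast h00
  have e10 : ((2 ^ Fintype.card α * #(𝒜₁ ∩ ℬ₀ᶜˢ) : ℕ) : ℤ) ≤ ((#𝒜₁ * #ℬ₀ : ℕ) : ℤ) := by exact_mod_cast h10
  have e01 : ((2 ^ Fintype.card α * #(ℬ₁ ∩ 𝒜₀ᶜˢ) : ℕ) : ℤ) ≤ ((#ℬ₁ * #𝒜₀ : ℕ) : ℤ) := by exact_mod_cast h01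
  push_cast at e11 e00 e10 e01
  nlinarith [e11, e00, e10, e01]

/-- **CROSS-HARRIS** (PROOFS §P70 (a3)–(a4)): for up-sets `𝒜₀ ⊆ 𝒜₁`, `ℬ₀ ⊆ ℬ₁` the antithetic cross-covariance sum is non-negative:
`0 ≤ Σ_s (𝟙_{𝒜₁}(s) − 𝟙_{𝒜₀}(sᶜ))(𝟙_{ℬ₁}(s) − 𝟙_{ℬ₀}(sᶜ))`.  Consequences: the edge-observer / one-sided glued cross functionals `Λ_C` of the
size-law programme are non-decreasing in `C`, and `Λ_C(G*, f) ≥ 0` outright when the observer pair `f` is at `x`.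
[cite: Harris1960, Lemma 4.1 (p. 16)] -/
theorem antithetic_crossSum_nonneg {𝒜₀ 𝒜₁ ℬ₀ ℬ₁ : Finset (Finset α)}
    (h𝒜 : 𝒜₀ ⊆ 𝒜₁) (hℬ : ℬ₀ ⊆ ℬ₁)
    (up𝒜₀ : IsUpperSet (𝒜₀ : Set (Finset α))) (up𝒜₁ : IsUpperSet (𝒜₁ : Set (Finset α)))
    (upℬ₀ : IsUpperSet (ℬ₀ : Set (Finset α))) (upℬ₁ : IsUpperSet (ℬ₁ : Set (Finset α))) :
    0 ≤ ∑ s : Finset α,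
        ((if s ∈ 𝒜₁ then (1:ℤ) else 0) - (if sᶜ ∈ 𝒜₀ then (1:ℤ) else 0)) *
          ((if s ∈ ℬ₁ then (1:ℤ) else 0) - (if sᶜ ∈ ℬ₀ then (1:ℤ) else 0)) := by
  have h := antithetic_crossSum_ge up𝒜₀ up𝒜₁ upℬ₀ upℬ₁
  have hA : (#𝒜₀ : ℤ) ≤ (#𝒜₁ : ℤ) := by exact_mod_cast Finset.card_le_card h𝒜
  have hB : (#ℬ₀ : ℤ) ≤ (#ℬ₁ : ℤ) := by exact_mod_cast Finset.card_le_card hℬ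
  have hprod : 0 ≤ ((#𝒜₁ : ℤ) - (#𝒜₀ : ℤ)) * ((#ℬ₁ : ℤ) - (#ℬ₀ : ℤ)) := mul_nonneg (by linarith) (by linarith)
  have hpow : (0 : ℤ) < (2 : ℤ) ^ Fintype.card α := pow_pos (by norm_num) _
  exact nonneg_of_mul_nonneg_right (hprod.trans h) hpow

end Summit.CriticalPhenomena.PercolationContinuityZ3.Theorems.CSH
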